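import Summits.Parity.GeneralizedHardyLittlewood.Theses.LeeYangFibres
import Summits.Parity.GeneralizedHardyLittlewood.Theorems.LeeYangFibresAbsoluteUpgradeSlices
import Summits.Parity.GeneralizedHardyLittlewood.Theorems.LeeYangFibresAbsoluteUpgradeSingularProductLogLog
import Summits.Parity.GeneralizedHardyLittlewood.Theorems.LeeYangFibresAbsoluteUpgradeTarget
import Literature.NumberTheory.Sieve.ClusterComplexity
import HarnessLib

/-!
# Crux `AbsoluteUpgrade` (stmt-Parity-14116) — strategist sketch (wall-breaker seat, 2026-08-17)

Typed statements behind `STRATEGY-CENSUS.md` (census headings `## Strengthen`, `## Decomposition`).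
Nothing here is a registered line: every `sorry` below is either provable-now bookkeeping (marked) or a
conjectural statement whose CONSUMED CONTENT the census shows to be the crux's known residual
(`RelativeDimOneLogLogRate ↔ DimOne`, Lines/Sketch.lean) or the target's parity core.

* §1 `UniformRelativeDimOne` (S⁺, t-uniform relative Dickson–Hardy–Littlewood) and the AMPLIFICATION
  theorem-in-waiting `dimOne_of_uniformRelativeDimOne` (tensor power over translates + exact Gallagher
  factorisation): the one genuinely non-linear use of relative accuracy found; no leverage (census S2).
* §2 the typed two-piece split `MajorArcsAbsolute` (provable from `RelativeDimOne` in the zero-free branch) ∧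
  `HighMassMinorArcs` (the piece that remains the whole crux) for `t = 2` (census D4/D5).
-/

noncomputable section

open scoped BigOperators
open Classical

namespace Summit.Parity.GeneralizedHardyLittlewood.Cruxes.AbsoluteUpgrade.Strategist

open Literature.NumberTheory.Sieve Finset MeasureTheory
open Summit.Parity.GeneralizedHardyLittlewood.Theses.LeeYangFibres

/-! ## §1 Strengthen: `t`-uniform relative Dickson–Hardy–Littlewood and amplification -/

/-- **S⁺ = `UniformRelativeDimOne`.** `RelativeDimOne` (Green–Tao Conj. 1.4 error shape `ε(β_∞∏β_p + N)`)
required UNIFORMLY in the number of forms `t ≤ (log log N)^A`, for every `A`, with the size bound scaled per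
form (`affLinSize Ψ N ≤ L·t`, since `affLinSize` is a sum over the forms). Relative accuracy only — no rate in
`N`. Implies `RelativeDimOne` (fixed `t`). [cite: GreenTao2010, Conj. 1.4] -/
def UniformRelativeDimOne : Prop :=
  ∀ (A L : ℕ), ∀ ε : ℝ, 0 < ε → ∃ N₀ : ℕ, ∀ N : ℕ, N₀ ≤ N → ∀ t : ℕ, 1 ≤ t →
    (t : ℝ) ≤ Real.log (Real.log N) ^ A → ∀ Ψ : Fin t → AffLinForm 1,
      IsNondegenerateSystem Ψ → affLinSize Ψ N ≤ L * t → ∀ K : Set (Fin 1 → ℝ), Convex ℝ K →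
        K ⊆ realBox 1 N →
          |vonMangoldtSum Ψ K N - archFactor Ψ K * singularProduct Ψ| ≤
            ε * (archFactor Ψ K * singularProduct Ψ + N)

/-- The translate-amplified system `Φ_D = (ψ_i(· + D_j))_{j < k, i < t}`: copy `j` of `Ψ` evaluated at
`n + D_j`, i.e. the affine forms `a_i n + (a_i D_j + b_i)` (same leading coefficients, constants `≤ 3LN`
when `|D_j| ≤ 2N`). Indexing `Fin (k * t) ≃ Fin k × Fin t` via `finProdFinEquiv`. [folklore] -/
def translateSystem {t k : ℕ} (Ψ : Fin t → AffLinForm 1) (D : Fin k → ℤ) : Fin (k * t) → AffLinForm 1 :=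
  fun m => ⟨(Ψ (finProdFinEquiv.symm m).2).coeff,
    (Ψ (finProdFinEquiv.symm m).2).coeff 0 * D (finProdFinEquiv.symm m).1 + (Ψ (finProdFinEquiv.symm m).2).const⟩

/-- The convex set of the translate system: `K_D = {x : x + D_j ∈ K for all j}` (with `D_0 = 0` this is
`K ∩ ⋂_j (K - D_j) ⊆ K`, an interval). [folklore] -/
def translateSet {k : ℕ} (K : Set (Fin 1 → ℝ)) (D : Fin k → ℤ) : Set (Fin 1 → ℝ) :=
  {x | ∀ j, (fun i => x i + (D j : ℝ)) ∈ K}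

/-- The translate box: `D : Fin (k+1) → ℤ` with `D 0 = 0` and `|D_j| ≤ 2N`. [folklore] -/
def translateBox (k N : ℕ) : Finset (Fin (k + 1) → ℤ) :=
  (Fintype.piFinset fun _ : Fin (k + 1) => Icc (-(2 * N : ℤ)) (2 * N)).filter fun D => D 0 = 0

/-- **Tensor identity (provable-now, exact combinatorics).** Summing the von Mangoldt sums of the translate
systems over all translates gives the `(k+1)`-st POWER of the original sum:
`Σ_{D ∈ box} S(Φ_D, K_D) = S(Ψ, K)^{k+1}` — because for `n ∈ K` the `D_j` with `n + D_j ∈ K` are exactly the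
`m - n`, `m ∈ K ∩ ℤ`. This is the structure a black-box functional (Disproof §3 `biasedModel`) lacks.
[folklore] -/
theorem tensorIdentity {t k : ℕ} (Ψ : Fin t → AffLinForm 1) (K : Set (Fin 1 → ℝ)) (N : ℕ)
    (hK : K ⊆ realBox 1 N) :
    ∑ D ∈ translateBox k N, vonMangoldtSum (translateSystem Ψ D) (translateSet K D) N =
      vonMangoldtSum Ψ K N ^ (k + 1) := by
  sorry

/-- **Gallagher over translates (provable-now, L/XL).** Prime by prime the translate average of the local
factor is EXACT: `E_{D mod p}[β_p(Φ_D)] = β_p(Ψ)^{k+1}` (a residue avoids `k+1` independent translates of the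
zero set `Z_p(Ψ)` with probability `(1 - ν_p/p)^{k+1}`); with box equidistribution modulo `P(z) = N^{δ}` and an
anatomy bound for the tail primes (`E[e^X] = 1 + O((tk)²/(z log z))`, collisions of differences at primes
`> z`) the main terms of the non-degenerate translates sum to `M(Ψ,K)^{k+1}(1 + η)`, `η → 0` uniformly for
`k + 1 ≤ (log log N)^A`, on systems of mass `≥ N` (so that `β_∞ ≥ N^{1-o(1)}`). [cite: Gallagher1976, Theorem 2] -/
theorem gallagherTranslates (t₀ L A : ℕ) (ht : 1 ≤ t₀) (ε : ℝ) (hε : 0 < ε) :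
    ∃ N₀ : ℕ, ∀ N : ℕ, N₀ ≤ N → ∀ k : ℕ, ((k : ℝ) + 1) ≤ Real.log (Real.log N) ^ A →
      ∀ Ψ : Fin t₀ → AffLinForm 1, IsNondegenerateSystem Ψ → affLinSize Ψ N ≤ L →
        ∀ K : Set (Fin 1 → ℝ), Convex ℝ K → K ⊆ realBox 1 N →
          (N : ℝ) ≤ archFactor Ψ K * singularProduct Ψ →
            |(∑ D ∈ (translateBox k N).filter (fun D => IsNondegenerateSystem (translateSystem Ψ D)),
                archFactor (translateSystem Ψ D) (translateSet K D) * singularProduct (translateSystem Ψ D)) -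
              (archFactor Ψ K * singularProduct Ψ) ^ (k + 1)| ≤
              ε * (archFactor Ψ K * singularProduct Ψ) ^ (k + 1) := by
  sorry

/-- **Amplification (theorem-in-waiting; proof = `tensorIdentity` + `gallagherTranslates` + root extraction
`|(1+θ)^{1/k} - 1| ≤ 2|θ|/k` with `k ≍ (log log N)^{t₀-1}` + the landed mass bound
`stub_singularProduct_le_loglog_pow` + `RelativeDimOne` on mass `≤ 8N`).** `t`-uniform RELATIVE
Dickson–Hardy–Littlewood implies ABSOLUTE Dickson–Hardy–Littlewood. CENSUS S2: the content of S⁺ that the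
proof consumes (S⁺ summed over the translates) is equivalent to `RelativeDimOneLogLogRate ↔ DimOne`
(Lines/Sketch.lean): amplification converts `t`-uniformity into the rate, it does not make the rate cheaper.
[cite: GreenTao2010, Conj. 1.2 and Conj. 1.4] -/
theorem dimOne_of_uniformRelativeDimOne (h : UniformRelativeDimOne) : DimOne := by
  sorry

/-- Hence S⁺ discharges the crux (hypothesis `RelativeDimOne` unused — the census's point). [folklore] -/
theorem absoluteUpgrade_of_uniformRelativeDimOne (h : UniformRelativeDimOne) : AbsoluteUpgrade :=
  fun _ => dimOne_of_uniformRelativeDimOne h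

/-! ## §2 Decomposition (typed, `t = 2`): major arcs absolute (provable from the hypothesis) ∧ high-mass
minor arcs pointwise (the piece that remains the whole crux) -/

/-- The prime exponential sum `S_N(α) = Σ_{1 ≤ n ≤ N} Λ(n) e(nα)`. [folklore] -/
def primeExpSum (N : ℕ) (α : ℝ) : ℂ :=
  ∑ n ∈ Icc 1 N, (ArithmeticFunction.vonMangoldt n : ℂ) * Complex.exp (2 * Real.pi * Complex.I * (n : ℂ) * (α : ℂ))

/-- Major arcs of level `Q`: `α ∈ [0,1]` within `Q/(qN)` of some `a/q`, `1 ≤ q ≤ Q`. [folklore] -/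
def majorArcs (N : ℕ) (Q : ℝ) : Set ℝ :=
  {α | α ∈ Set.Icc (0 : ℝ) 1 ∧ ∃ q : ℕ, 1 ≤ q ∧ (q : ℝ) ≤ Q ∧ ∃ a : ℤ, |α - a / q| ≤ Q / (q * N)}

/-- Minor arcs of level `Q`. [folklore] -/
def minorArcs (N : ℕ) (Q : ℝ) : Set ℝ := Set.Icc (0 : ℝ) 1 \ majorArcs N Q

/-- The minor-arc contribution to the pair count at shift `h`: `m_Q(h) = ∫_𝔪 |S_N(α)|² e(-hα) dα` (real part;
the imaginary part cancels by `α ↦ 1 - α`). [folklore] -/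
def minorArcIntegral (N : ℕ) (Q : ℝ) (h : ℤ) : ℝ :=
  ∫ α in minorArcs N Q, (‖primeExpSum N α‖ ^ 2 *
    Complex.exp (-(2 * Real.pi * Complex.I * (h : ℂ) * (α : ℂ)))).re

/-- The pair sum `Σ_{1 ≤ n, n+h ≤ N} Λ(n)Λ(n+h)` written with the tree's objects: `vonMangoldtSum` of
`shiftPairSystem h` on `K = [1, N - h]` (for `0 ≤ h`). [folklore] -/
def pairBox (N : ℕ) (h : ℤ) : Set (Fin 1 → ℝ) := Set.Icc (fun _ => (1 : ℝ)) (fun _ => ((N : ℝ) - h))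

/-- **Sub₁ = `MajorArcsAbsolute` (provable from `RelativeDimOne`, XL).** In the zero-free branch
(`RelativeDimOne → NoSiegelZeros`, landed p89962) the major arcs of level `Q = exp(c √log N)` evaluate the pair
count to `β_∞ ∏_p β_p` with ABSOLUTE error `εN`, uniformly in `0 ≤ h ≤ N` — singular-series tail included
(Rankin: `Σ_{q ∣ h, q > Q} μ²/φ ≤ (log log N)^e · Q^{-1/log log N} → 0`). [cite: MontgomeryVaughanActa1975, §§5–7] -/
def MajorArcsAbsolute : Prop :=
  ∀ ε : ℝ, 0 < ε → ∃ c : ℝ, 0 < c ∧ ∃ N₀ : ℕ, ∀ N : ℕ, N₀ ≤ N → ∀ h : ℤ, 0 ≤ h → h ≤ N →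
    |vonMangoldtSum (shiftPairSystem h) (pairBox N h) N
        - archFactor (shiftPairSystem h) (pairBox N h) * singularProduct (shiftPairSystem h)
        - minorArcIntegral N (Real.exp (c * Real.sqrt (Real.log N))) h| ≤ ε * N

/-- **Sub₂ = `HighMassMinorArcs` (the piece that remains the whole crux).** The minor-arc integral is `o(N)`
POINTWISE at every shift of singular series `≥ K₀`. Under `RelativeDimOne` it is `o(𝔖(h) N)`; positivity of
`|S_N|² 1_𝔪` gives only Fejér means along shift lattices; this is `CircleMethodBinaryBarrier` at aligned shifts.
[cite: MontgomeryVaughanActa1975, §8] -/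
def HighMassMinorArcs : Prop :=
  ∀ ε : ℝ, 0 < ε → ∀ c : ℝ, 0 < c → ∃ K₀ : ℝ, ∃ N₀ : ℕ, ∀ N : ℕ, N₀ ≤ N → ∀ h : ℤ, 0 ≤ h → h ≤ N →
    K₀ ≤ singularProduct (shiftPairSystem h) →
      |minorArcIntegral N (Real.exp (c * Real.sqrt (Real.log N))) h| ≤ ε * N

/-- `DimOne` restricted to `t = 2` shift pairs on `[1, N-h]` (the inhabited hard family of the crux,
`exists_highMass_pair`). [folklore] -/
def DimOnePairs : Prop :=
  ∀ ε : ℝ, 0 < ε → ∃ N₀ : ℕ, ∀ N : ℕ, N₀ ≤ N → ∀ h : ℤ, 0 ≤ h → h ≤ N →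
    |vonMangoldtSum (shiftPairSystem h) (pairBox N h) N
        - archFactor (shiftPairSystem h) (pairBox N h) * singularProduct (shiftPairSystem h)| ≤ ε * N

/-- **Glue of the split (provable-now bookkeeping): Sub₁ ∧ Sub₂ and the hypothesis give the pair family
absolutely** — low mass from `RelativeDimOne` directly, high mass from Sub₁ + Sub₂. The census records why this
split has one piece equal to the core: in circle normal form the lattice/coset means of the error are null on
`𝔪`, so every "fluctuation" formulation of Sub₂ is Sub₂ again. [folklore] -/
theorem dimOnePairs_of_split (h₁ : RelativeDimOne → MajorArcsAbsolute) (h₂ : HighMassMinorArcs)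
    (hR : RelativeDimOne) : DimOnePairs := by
  sorry

end Summit.Parity.GeneralizedHardyLittlewood.Cruxes.AbsoluteUpgrade.Strategist
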